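import Summits.AtomisticToContinuum.FouriersLaw.Theses.HonestZwanzig
import Summits.AtomisticToContinuum.FouriersLaw.Theorems.HonestZwanzigFeshbachIdentitiesLaplacePositivity
import Summits.AtomisticToContinuum.FouriersLaw.Theorems.HonestZwanzigFeshbachIdentitiesSiteEnergy
import Summits.AtomisticToContinuum.FouriersLaw.Theorems.BondHeatUncertaintyExtensiveSnapshotIrreversibilityTapDualityOddCorrectorAux1

/-!
# HonestZwanzig / OrthogonalOhm — stub F `G0PosDef`, part 2: the zero-frequency autocorrelation is a Dirichlet form

Support file for crux item `stmt-AtomisticToContinuum-12693` (`HonestZwanzig.OrthogonalOhm`, sub-problem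
`FouriersLaw`), line `Sketch`, stub F `stub_G0PosDef` (positive definiteness of the zero-frequency energy Gram
matrix `G(0)`; in skeleton v5 the F-programme F1a/F1b/F2/F3).

Pinned anharmonic chain `P = pinnedChain ω₂ lam β γ` (all parameters `> 0`), `N ≥ 1`, both baths at `T > 0`,
`μ_T = gibbsMeasure N T`, `P_t = transitionKernel N T T t`, `ρ = e^{-H/T}`, `Z = ∫ ρ`.

* `exists_poisson_lap_zero` — **the analytic half of stub F**: for a smooth nice observable `u`
  (`|u| ≤ C e^{ϑH}`, `2ϑ < 1/T`) with Gibbs mean `m`, there is a SMOOTH classical solution `v` of the Poisson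
  equation `L_{T,T} v = -(u - m)` with `∂_{p_b} v ∈ L²(μ_T)` at the bath sites and
  `∫₀^∞ corr(u,u)(t) dt = Z⁻¹ γT ∑_i ([i=0]+[i=N-1]) ∫ (∂_{p_i} v)² ρ dx ≥ 0`.
  Everything is assembled from proved tree theorems: exponential mixing (`pinnedChain_harris_bound`, CEHR (2.5))
  makes `∫₀^∞ P_t(u - m) dt` converge; its hypoelliptic modification `v` solves the Poisson equation pointwise
  (`TapDuality.poisson_smooth_of_decay`: the tree's Hörmander pipeline); Fubini and the invariance of `μ_T`
  give `∫₀^∞ corr(u,u) = ⟨u - m, v⟩_{μ_T}` (`TapDuality.pairing_fubini`); and the tap energy identity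
  `⟨u - m, v⟩ = ⟨-Lv, v⟩ = γT ∑_b ‖∂_{p_b} v‖²` (`Corrector.integral_mul_source_eq_dirichlet`).
* `contDiff_splitSite` — the split site energies `e_x` are smooth;
* `splitSite_sliceP`, `energyProfile_sliceP`, `splitSite_sliceQ`, `energyProfile_sliceQ` — coordinate slices of
  `e_y` and of an energy profile `u = ∑ ξ_y e_y` along `p_k ↦ t` and `q_k ↦ t` (pure algebra, any chain), used by
  the bracket induction of part 3.

References: Cuneo–Eckmann–Hairer–Rey-Bellet 2018, Thm 2.13; L. Hörmander, Acta Math. 119 (1967), Thm 1.1.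
-/

noncomputable section

open MeasureTheory ProbabilityTheory Filter Topology Finset
open scoped NNReal ENNReal ContDiff
open Literature.MathematicalPhysics.KineticTheory.HeatConduction
open Summit.AtomisticToContinuum.FouriersLaw.Theorems.OddSectorIrreversibility
open Summit.AtomisticToContinuum.FouriersLaw.Theorems.OddSectorIrreversibility.Corrector
open Summit.AtomisticToContinuum.FouriersLaw.Theorems.ExtensiveSnapshotIrreversibility.TapDuality
open Summit.AtomisticToContinuum.FouriersLaw.Theorems.SuperadditiveResistance.Kubo
open Summit.AtomisticToContinuum.FouriersLaw.Theorems.SubdiffusiveBondHeat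

namespace Summit.AtomisticToContinuum.FouriersLaw.Theorems.HonestZwanzig

namespace OrthogonalOhmLine.G0PosDef

variable {N : ℕ}

/-! ### Slices of an energy profile -/

section Profile

variable (P : OscillatorChain) {e : Fin N → PhaseSpace N → ℝ}
  (he : ∀ x z, e x z = z.2 x ^ 2 / 2 + P.U (z.1 x) +
    ∑ j : Fin N, ((if j.val = x.val + 1 then P.V (z.1 j - z.1 x) / 2 else 0) +
      (if x.val = j.val + 1 then P.V (z.1 x - z.1 j) / 2 else 0)))
include he

/-- The `p_k`-slice of a split site energy: only the kinetic term of `e_k` moves. -/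
theorem splitSite_sliceP (y k : Fin N) (z : PhaseSpace N) (t : ℝ) :
    e y (z.1, Function.update z.2 k t) = e y z + (if y = k then (t ^ 2 - z.2 k ^ 2) / 2 else 0) := by
  rw [he, he]
  dsimp only
  by_cases hyk : y = k
  · subst hyk
    rw [if_pos rfl, Function.update_self]
    ring
  · rw [if_neg hyk, Function.update_of_ne hyk, add_zero]

/-- The `p_k`-slice of the energy profile `u = ∑ ξ_y e_y`: `u(q, p[k ↦ t]) = u(q,p) + ξ_k (t² - p_k²)/2`. -/
theorem energyProfile_sliceP (ξ : Fin N → ℝ) (k : Fin N) (z : PhaseSpace N) (t : ℝ) :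
    ∑ y, ξ y * e y (z.1, Function.update z.2 k t) = ∑ y, ξ y * e y z + ξ k * (t ^ 2 - z.2 k ^ 2) / 2 := by
  have : ∀ y ∈ (univ : Finset (Fin N)), ξ y * e y (z.1, Function.update z.2 k t) =
      ξ y * e y z + (if y = k then ξ k * (t ^ 2 - z.2 k ^ 2) / 2 else 0) := by
    intro y _
    rw [splitSite_sliceP P he]
    by_cases hyk : y = k
    · subst hyk; rw [if_pos rfl, if_pos rfl]; ring
    · rw [if_neg hyk, if_neg hyk]; ring
  rw [Finset.sum_congr rfl this, Finset.sum_add_distrib, Finset.sum_ite_eq' univ k, if_pos (mem_univ _)]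

/-- The `q_k`-slice of a split site energy `e_y` with `y ∉ {k-1, k}`: only the half bond `(k, k+1)` of
`e_{k+1}` moves. -/
theorem splitSite_sliceQ {k c : Fin N} (hc : c.val = k.val + 1) {y : Fin N} (hyk : y ≠ k)
    (hya : y.val + 1 ≠ k.val) (z : PhaseSpace N) (t : ℝ) :
    e y (Function.update z.1 k t, z.2) =
      e y z + (if y = c then (P.V (z.1 c - t) - P.V (z.1 c - z.1 k)) / 2 else 0) := by
  rw [he, he]
  simp only [Function.update_of_ne hyk]
  have hA : ∀ j : Fin N, (if j.val = y.val + 1 then P.V (Function.update z.1 k t j - z.1 y) / 2 else 0) =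
      (if j.val = y.val + 1 then P.V (z.1 j - z.1 y) / 2 else 0) := by
    intro j
    by_cases hjk : j = k
    · subst hjk
      have : ¬ (j.val = y.val + 1) := fun h => hya h.symm
      rw [if_neg this, if_neg this]
    · rw [Function.update_of_ne hjk]
  have hB : ∀ j : Fin N, (if y.val = j.val + 1 then P.V (z.1 y - Function.update z.1 k t j) / 2 else 0) =
      (if y.val = j.val + 1 then P.V (z.1 y - z.1 j) / 2 else 0) +
        (if j = k then (if y = c then (P.V (z.1 c - t) - P.V (z.1 c - z.1 k)) / 2 else 0) else 0) := by
    intro j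
    by_cases hjk : j = k
    · subst hjk
      rw [Function.update_self, if_pos rfl]
      by_cases hyc : y = c
      · subst hyc
        rw [if_pos hc, if_pos hc, if_pos rfl]
        ring
      · have : ¬ (y.val = j.val + 1) := fun h => hyc (Fin.ext (by omega))
        rw [if_neg this, if_neg this, if_neg hyc]
        ring
    · rw [Function.update_of_ne hjk, if_neg hjk, add_zero]
  simp only [hA, hB, Finset.sum_add_distrib, Finset.sum_ite_eq' univ k, if_pos (mem_univ _)]
  ring

/-- The `q_k`-slice of the energy profile `u = ∑ ξ_y e_y` when `ξ_{k-1} = ξ_k = 0`: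
`u(q[k ↦ t], p) = u(q,p) + ξ_{k+1} (V(q_{k+1} - t) - V(q_{k+1} - q_k))/2`. -/
theorem energyProfile_sliceQ (ξ : Fin N → ℝ) {k c : Fin N} (hc : c.val = k.val + 1) (hξk : ξ k = 0)
    (hξa : ∀ a : Fin N, a.val + 1 = k.val → ξ a = 0) (z : PhaseSpace N) (t : ℝ) :
    ∑ y, ξ y * e y (Function.update z.1 k t, z.2) =
      ∑ y, ξ y * e y z + ξ c * (P.V (z.1 c - t) - P.V (z.1 c - z.1 k)) / 2 := by
  have hck : c ≠ k := fun h => by rw [h] at hc; omega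
  have : ∀ y ∈ (univ : Finset (Fin N)), ξ y * e y (Function.update z.1 k t, z.2) =
      ξ y * e y z + (if y = c then ξ c * (P.V (z.1 c - t) - P.V (z.1 c - z.1 k)) / 2 else 0) := by
    intro y _
    by_cases hyk : y = k
    · subst hyk
      rw [hξk, zero_mul, zero_mul, if_neg (Ne.symm hck), add_zero]
    by_cases hya : y.val + 1 = k.val
    · have hyc : y ≠ c := fun h => by rw [h] at hya; omega
      rw [hξa y hya, zero_mul, zero_mul, if_neg hyc, add_zero]
    rw [splitSite_sliceQ P he hc hyk hya]
    by_cases hyc : y = c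
    · subst hyc; rw [if_pos rfl, if_pos rfl]; ring
    · rw [if_neg hyc, if_neg hyc]; ring
  rw [Finset.sum_congr rfl this, Finset.sum_add_distrib, Finset.sum_ite_eq' univ c, if_pos (mem_univ _)]

end Profile

section Smooth

variable {ω₂ lam β γ : ℝ} {e : Fin N → PhaseSpace N → ℝ}
  (he : ∀ x z, e x z = z.2 x ^ 2 / 2 + (pinnedChain ω₂ lam β γ).U (z.1 x) +
    ∑ j : Fin N, ((if j.val = x.val + 1 then (pinnedChain ω₂ lam β γ).V (z.1 j - z.1 x) / 2 else 0) +
      (if x.val = j.val + 1 then (pinnedChain ω₂ lam β γ).V (z.1 x - z.1 j) / 2 else 0)))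
include he

/-- The split site energies of the pinned chain are smooth. -/
theorem contDiff_splitSite (x : Fin N) : ContDiff ℝ ∞ (e x) := by
  rw [splitSite_eq e he x]
  have hU : ContDiff ℝ ∞ (pinnedChain ω₂ lam β γ).U := pinnedChain_contDiff_U ω₂ lam β γ
  have hV : ContDiff ℝ ∞ (pinnedChain ω₂ lam β γ).V := pinnedChain_contDiff_V ω₂ lam β γ
  have h1 : ∀ i : Fin N, ContDiff ℝ ∞ fun z : PhaseSpace N => z.2 i :=
    fun i => (contDiff_apply ℝ ℝ i).comp contDiff_snd
  have h2 : ∀ i : Fin N, ContDiff ℝ ∞ fun z : PhaseSpace N => z.1 i :=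
    fun i => (contDiff_apply ℝ ℝ i).comp contDiff_fst
  refine ((((h1 x).pow 2).div_const 2).add (hU.comp (h2 x))).add (ContDiff.sum fun j _ => ContDiff.add ?_ ?_)
  · by_cases h : j.val = x.val + 1
    · simp only [h, if_true]; exact (hV.comp ((h2 j).sub (h2 x))).div_const 2
    · simp only [h, if_false]; exact contDiff_const
  · by_cases h : x.val = j.val + 1
    · simp only [h, if_true]; exact (hV.comp ((h2 x).sub (h2 j))).div_const 2
    · simp only [h, if_false]; exact contDiff_const

end Smooth

section Analytic

variable {ω₂ lam β γ : ℝ} (hω : 0 < ω₂) (hl : 0 < lam) (hβ : 0 < β) (hγ : 0 < γ) (hN : 0 < N)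
  {T : ℝ} (hT : 0 < T)
include hω hl hβ hγ hN hT

/-- **The zero-frequency autocorrelation is a Dirichlet form.**  For a smooth nice observable `u`
(`|u| ≤ C_u e^{ϑH}`, `0 < ϑ`, `2ϑ < 1/T`) with Gibbs mean `m`, there is a smooth classical solution `v` of the
Poisson equation `L_{T,T} v = -(u - m)` (the hypoelliptic modification of `∫₀^∞ P_t(u - m) dt`), with
`∂_{p_b} v ∈ L²(μ_T)` at the bath sites, such that
`∫₀^∞ corr(u,u)(t) dt = Z⁻¹ · γT ∑_i ([i=0]+[i=N-1]) ∫ (∂_{p_i} v)² e^{-H/T} dx`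
(Fubini + invariance of `μ_T`: `∫₀^∞ corr(u,u) = ⟨u - m, v⟩_{μ_T}`; then the tap energy identity
`⟨u - m, v⟩ = ⟨-L v, v⟩ = γT ∑_b ‖∂_{p_b} v‖²`). -/
theorem exists_poisson_lap_zero {ϑ : ℝ} (hϑ0 : 0 < ϑ) (h2ϑ : 2 * ϑ < 1 / T)
    {u : PhaseSpace N → ℝ} (hus : ContDiff ℝ ∞ u) {Cu : ℝ} (hCu : 0 ≤ Cu)
    (hub : ∀ y, |u y| ≤ Cu * Real.exp (ϑ * (pinnedChain ω₂ lam β γ).hamiltonian N y)) :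
    ∃ v : PhaseSpace N → ℝ, ContDiff ℝ ∞ v ∧
      (∀ x, (pinnedChain ω₂ lam β γ).generator N T T v x =
        -(u x - ∫ w, u w ∂((pinnedChain ω₂ lam β γ).gibbsMeasure N T))) ∧
      (∀ i : Fin N, 0 < OscillatorChain.bathWeight N i →
        MemLp (partialP i v) 2 ((pinnedChain ω₂ lam β γ).gibbsMeasure N T)) ∧
      ∫ t in Set.Ioi (0 : ℝ), Real.exp (-(0 * t)) *
        ((∫ z, u z * (∫ y, u y ∂((pinnedChain ω₂ lam β γ).transitionKernel N T T t.toNNReal z))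
            ∂((pinnedChain ω₂ lam β γ).gibbsMeasure N T)) -
          (∫ z, u z ∂((pinnedChain ω₂ lam β γ).gibbsMeasure N T)) *
            (∫ z, u z ∂((pinnedChain ω₂ lam β γ).gibbsMeasure N T))) =
        (∫ x, (pinnedChain ω₂ lam β γ).gibbsDensity N T x)⁻¹ *
          (γ * T * ∑ i : Fin N, OscillatorChain.bathWeight N i *
            ∫ x, partialP i v x ^ 2 * (pinnedChain ω₂ lam β γ).gibbsDensity N T x) := by
  have hϑ1 : ϑ < 1 / T := by linarith
  set P := pinnedChain ω₂ lam β γ with hP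
  set μ := P.gibbsMeasure N T with hμ
  set κ := P.transitionKernel N T T with hκ
  haveI : IsProbabilityMeasure μ := pinnedChain_isProbabilityMeasure_gibbsMeasure hω hl.le hβ.le γ N hT
  haveI : ∀ s, IsMarkovKernel (κ s) := fun s => pinnedChain_isMarkovKernel_transitionKernel hω hl.le hβ.le hγ.le N T T s
  have huc : Continuous u := hus.continuous
  set m : ℝ := ∫ w, u w ∂μ with hm
  set k : PhaseSpace N → ℝ := fun z => u z - m with hk
  have hkc : Continuous k := huc.sub continuous_const
  have hks : ContDiff ℝ ∞ k := hus.sub contDiff_const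
  have hkb : ∀ y, |k y| ≤ (Cu + |m|) * Real.exp (ϑ * P.hamiltonian N y) := fun y => by
    have h1 := hub y
    have h2 : |m| ≤ |m| * Real.exp (ϑ * P.hamiltonian N y) :=
      le_mul_of_one_le_right (abs_nonneg _) (pinnedChain_one_le_exp_mul_hamiltonian hω hl.le hβ hϑ0.le y)
    calc |u y - m| ≤ |u y| + |m| := abs_sub _ _
      _ ≤ Cu * Real.exp (ϑ * P.hamiltonian N y) + |m| * Real.exp (ϑ * P.hamiltonian N y) := add_le_add h1 h2
      _ = (Cu + |m|) * Real.exp (ϑ * P.hamiltonian N y) := by ring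
  have hC0 : 0 ≤ Cu + |m| := by positivity
  -- `μ_T(k) = 0`
  have hui : Integrable u μ := pinnedChain_integrable_nice hω hl.le hβ hT hϑ1 huc hub
  have hki : Integrable k μ := hui.sub (integrable_const m)
  have hk0 : ∫ z, k z ∂μ = 0 := by
    have h1 : ∫ z, k z ∂μ = (∫ z, u z ∂μ) - ∫ _z, m ∂μ := integral_sub hui (integrable_const m)
    have h2 : ∫ _z : PhaseSpace N, m ∂μ = m := by
      rw [integral_const, probReal_univ, one_smul]
    rw [h1, h2]
    linarith [hm]
  -- decay of the forecasts of `k`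
  obtain ⟨K, c, hK, hc, hb⟩ := pinnedChain_harris_bound hω hl.le hβ hγ hN hT hϑ0 hϑ1
  have hdecay : ∀ (t : ℝ≥0) (z : PhaseSpace N), |∫ y, k y ∂(κ t z)| ≤
      K * (Cu + |m|) * Real.exp (ϑ * P.hamiltonian N z) * Real.exp (-c * t) := by
    intro t z
    have h := hb z t k hkc (Cu + |m|) hC0 hkb
    rwa [hk0, sub_zero] at h
  -- the smooth Poisson solution
  obtain ⟨v, hv, hae, hpde, K', hK', hvb⟩ :=
    poisson_smooth_of_decay hω hl hβ hγ hT hN hϑ0 hϑ1 hc hks hkb hdecay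
  have hv2 : ContDiff ℝ 2 v := hv.of_le (by norm_cast)
  have hvc : Continuous v := hv.continuous
  have hvL2 : MemLp v 2 μ :=
    (memLp_two_iff_integrable_sq hvc.aestronglyMeasurable).2
      (pinnedChain_integrable_sq_nice hω hl.le hβ hT h2ϑ hvc hvb)
  have hkL2 : MemLp k 2 μ :=
    (memLp_two_iff_integrable_sq hkc.aestronglyMeasurable).2
      (pinnedChain_integrable_sq_nice hω hl.le hβ hT h2ϑ hkc hkb)
  have hmem : ∀ i : Fin N, 0 < OscillatorChain.bathWeight N i → MemLp (partialP i v) 2 μ :=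
    fun i hi => memLp_partialP_of_poisson hω hl.le hβ.le hγ hT hv2 hvL2 hkL2 hpde hi
  refine ⟨v, hv, hpde, hmem, ?_⟩
  -- the tap energy identity
  have hdir := integral_mul_source_eq_dirichlet hω hl.le hβ.le hγ hT hv2 hvL2 hkc hkL2 hpde
  -- `corr(u,u)(t) = ∫ k · P_t k dμ`
  have hki' : ∀ (t : ℝ≥0) (z : PhaseSpace N), Integrable k (κ t z) := fun t z =>
    pinnedChain_integrable_transitionKernel_of_abs_le hω hl.le hN hT hβ.le hγ.le hϑ0 hϑ1 hkc hkb t z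
  have hui' : ∀ (t : ℝ≥0) (z : PhaseSpace N), Integrable u (κ t z) := fun t z =>
    pinnedChain_integrable_transitionKernel_of_abs_le hω hl.le hN hT hβ.le hγ.le hϑ0 hϑ1 huc hub t z
  have hcorr : ∀ t : ℝ, (∫ z, u z * (∫ y, u y ∂(κ t.toNNReal z)) ∂μ) - m * m =
      ∫ z, k z * (∫ y, k y ∂(κ t.toNNReal z)) ∂μ := by
    intro t
    rw [hm, pinnedChain_corr_eq_integral_sub hω hl.le hβ hγ hN hT hϑ0 h2ϑ huc huc hub hub t.toNNReal, ← hm]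
    have hPk : ∀ z, ∫ y, k y ∂(κ t.toNNReal z) = (∫ y, u y ∂(κ t.toNNReal z)) - m := by
      intro z
      have h1 : ∫ y, k y ∂(κ t.toNNReal z) = (∫ y, u y ∂(κ t.toNNReal z)) - ∫ _y, m ∂(κ t.toNNReal z) :=
        integral_sub (hui' _ z) (integrable_const m)
      rw [h1, integral_const, probReal_univ, one_smul]
    have hI1 : Integrable (fun z => u z * ∫ y, k y ∂(κ t.toNNReal z)) μ :=
      pinnedChain_integrable_mul_act_nice hω hl.le hβ hγ hN hT hϑ0 h2ϑ huc hkc hub hkb _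
    have hI2 : Integrable (fun z => ∫ y, k y ∂(κ t.toNNReal z)) μ := by
      have h := pinnedChain_integrable_mul_act_nice hω hl.le hβ hγ hN hT hϑ0 h2ϑ continuous_const hkc
        (f := fun _ => (1 : ℝ)) (Cf := 1)
        (fun y => by rw [abs_one, one_mul]; exact pinnedChain_one_le_exp_mul_hamiltonian hω hl.le hβ hϑ0.le y) hkb
        t.toNNReal
      simpa only [one_mul] using h
    have hinv : ∫ z, (∫ y, k y ∂(κ t.toNNReal z)) ∂μ = 0 := by
      rw [pinnedChain_integral_transitionKernel_gibbsMeasure hω hl.le hβ.le hγ.le hN hT _ hki, hk0]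
    have e1 : (fun z => k z * ∫ y, k y ∂(κ t.toNNReal z)) =
        fun z => u z * (∫ y, k y ∂(κ t.toNNReal z)) - m * ∫ y, k y ∂(κ t.toNNReal z) := by
      funext z; simp only [hk]; ring
    rw [e1, integral_sub hI1 (hI2.const_mul m), integral_const_mul, hinv, mul_zero, sub_zero]
    refine integral_congr_ae (Eventually.of_forall fun z => ?_)
    simp only [hPk, hm]
    rfl
  -- Fubini and the a.e. identification with `v`
  obtain ⟨-, hfub⟩ := pairing_fubini hω hl hβ hT hγ.le h2ϑ hc hkc hkc hkb hdecay
  have hZ : ∀ t : ℝ, ∫ z, k z * (∫ y, k y ∂(κ t.toNNReal z)) ∂μ =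
      (∫ x, P.gibbsDensity N T x)⁻¹ * ∫ z, k z * (∫ y, k y ∂(κ t.toNNReal z)) * P.gibbsDensity N T z :=
    fun t => P.integral_gibbsMeasure _
  simp only [zero_mul, neg_zero, Real.exp_zero, one_mul]
  simp only [hcorr, hZ]
  rw [integral_const_mul, hfub]
  congr 1
  have hae' : ∫ z, k z * (∫ t in Set.Ioi (0 : ℝ), ∫ y, k y ∂(κ t.toNNReal z)) * P.gibbsDensity N T z =
      ∫ z, v z * k z * P.gibbsDensity N T z := by
    refine integral_congr_ae ?_
    filter_upwards [hae] with z hz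
    rw [hz]; ring
  rw [hae', hdir]

end Analytic

end OrthogonalOhmLine.G0PosDef

/-! ## Registered helper stub -/

open OrthogonalOhmLine.G0PosDef in
/-- **Registered helper stub of this file** (`helper_g0PosDefLapZeroDirichlet`, sub-goal of stub F `stub_G0PosDef` of
crux stmt-AtomisticToContinuum-12693): the zero-frequency autocorrelation of a smooth nice observable is `Z⁻¹` times
the Dirichlet form of a smooth Poisson solution (= `exists_poisson_lap_zero`).
[cite: CuneoEckmannHairerReyBellet2018, Thm 2.13] [cite: Hormander1967, Thm 1.1] -/
theorem helper_g0PosDefLapZeroDirichlet : ∀ (ω₂ lam β γ : ℝ), 0 < ω₂ → 0 < lam → 0 < β → 0 < γ → ∀ (N : ℕ), 0 < N → ∀ (T : ℝ), 0 < T → ∀ (ϑ : ℝ), 0 < ϑ → 2 * ϑ < 1 / T → ∀ (u : Literature.MathematicalPhysics.KineticTheory.HeatConduction.PhaseSpace N → ℝ), ContDiff ℝ (⊤ : ℕ∞) u → ∀ (Cu : ℝ), 0 ≤ Cu → (∀ y, |u y| ≤ Cu * Real.exp (ϑ * (Literature.MathematicalPhysics.KineticTheory.HeatConduction.pinnedChain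 ω₂ lam β γ).hamiltonian N y)) → ∃ v : Literature.MathematicalPhysics.KineticTheory.HeatConduction.PhaseSpace N → ℝ, ContDiff ℝ (⊤ : ℕ∞) v ∧ (∀ x, (Literature.MathematicalPhysics.KineticTheory.HeatConduction.pinnedChain ω₂ lam β γ).generator N T T v x = -(u x - ∫ w, u w ∂((Literature.MathematicalPhysics.KineticTheory.HeatConduction.pinnedChain ω₂ lam β γ).gibbsMeasure N T))) ∧ (∀ i : Fin N, 0 < Literature.MathematicalPhysics.KineticTheory.HeatConduction.OscillatorChain.bathWeight N i → MeasureTheory.MemLp (Literature.MathematicalPhysics.KineticTheory.HeatConduction.partialP i v) 2 ((Literature.MathematicalPhysics.KineticTheory.HeatConduction.pinnedChain ω₂ lam β γ).gibbsMeasure N T)) ∧ ∫ t in Set.Ioi (0 : ℝ), Real.exp (-(0 * t)) * ((∫ z, u z * (∫ y, u y ∂((Literature.MathematicalPhysics.KineticTheory.HeatConduction.pinnedChain ω₂ lam β γ).transitionKernel N T T t.toNNReal z)) ∂((Literature.MathematicalPhysics.KineticTheory.HeatConduction.pinnedChain ω₂ lam β γ).gibbsMeasure N T)) - (∫ z, u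 z ∂((Literature.MathematicalPhysics.KineticTheory.HeatConduction.pinnedChain ω₂ lam β γ).gibbsMeasure N T)) * (∫ z, u z ∂((Literature.MathematicalPhysics.KineticTheory.HeatConduction.pinnedChain ω₂ lam β γ).gibbsMeasure N T))) = (∫ x, (Literature.MathematicalPhysics.KineticTheory.HeatConduction.pinnedChain ω₂ lam β γ).gibbsDensity N T x)⁻¹ * (γ * T * ∑ i : Fin N, Literature.MathematicalPhysics.KineticTheory.HeatConduction.OscillatorChain.bathWeight N i * ∫ x, Literature.MathematicalPhysics.KineticTheory.HeatConduction.partialP i v x ^ 2 * (Literature.MathematicalPhysics.KineticTheory.HeatConduction.pinnedChain ω₂ lam β γ).gibbsDensity N T x) :=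
  fun _ _ _ _ hω hl hβ hγ _ hN _ hT _ hϑ0 h2ϑ _ hus _ hCu hub =>
    exists_poisson_lap_zero hω hl hβ hγ hN hT hϑ0 h2ϑ hus hCu hub

end Summit.AtomisticToContinuum.FouriersLaw.Theorems.HonestZwanzig

end
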